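import Literature.NumberTheory.PAdicHodge.AinfWeierstrassHodgeTateClass
import HarnessLib

/-!
# `gr¹B_dR⁺ ≅ ℂ_F`: the coordinate `x = ξ_dR·y ↦ θ(y)` on `Fil¹`, and the Hodge–Tate coordinate `θ([t]/ξ) ∈ 𝒪_{ℂ_F}` of a
# Tate-module point of `Ŵ`

Topic `Literature/NumberTheory/PAdicHodge`; sequel of `AinfWeierstrassHodgeTateClass`. `B_dR⁺(F)` is a domain (tree
`isDomain_bDeRhamPlus`, under the standing surjectivity of `θ`) with `Fil¹ = (ξ_dR)`, so every `x ∈ Fil¹` is `ξ_dR·y` for a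
unique `y`, and `x ↦ θ(y) ∈ ℂ_F` is an additive map `Fil¹ → ℂ_F` killing exactly `Fil²`: the identification
`gr¹B_dR⁺ ≅ ℂ_F` (as groups; `Γ_F` acts through the cocycle `θ(σξ_dR/ξ_dR)`, i.e. `gr¹ ≅ ℂ_F(1)`).

* `BdRPlusTop.grCoord hθ x` (`x ∈ Fil¹`) — `θ(x/ξ_dR)`; `grCoord_spec`, `grCoord_add`, `grCoord_eq_zero_iff` (`↔ x ∈ Fil²`);
* **`AinfTop.htCoord W t := θ([t]/ξ_dR) ∈ ℂ_F`** — the Hodge–Tate coordinate of a Tate-module point of `Ŵ(𝒪_{ℂ_F})`;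
  **`htCoord_addSeq`** (additive), `htCoord_eq_zero_iff` (`↔ HT(t) = 0 ↔ [t] ∈ Fil²`).

Tate's theorem (`htCoord t = 0 → t = 0` on `ℤ_p`-points for good reduction) is NOT proved here. Definitions (reviewed):
`grCoord`, `htCoord`. No named facts, no `sorry`.

## References
* J.-M. Fontaine, *Le corps des périodes p-adiques*, Astérisque 223 (1994), Exp. II §1.5.2–1.5.5. [FontaineAsterisque223III]
* J. T. Tate, *p-divisible groups* (Driebergen 1966), Springer 1967, §4. [Tate1967]
* J.-M. Fontaine, *Formes différentielles et modules de Tate…*, Invent. Math. 65 (1982), §5. [Fontaine1982FormesDifferentielles]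
-/

noncomputable section

open Ideal Field WittVector MvPowerSeries

namespace Literature.NumberTheory.PAdicHodge

open Literature.NumberTheory.GaloisRepresentations
open Literature.NumberTheory.GaloisRepresentations.IsNonarchimedeanLocalField
open Literature.NumberTheory.GaloisRepresentations.LubinTate

variable {F : Type} [Field F] [ValuativeRel F] [TopologicalSpace F] [IsNonarchimedeanLocalField F] [CharZero F]
  {p : ℕ} [Fact p.Prime] [Fact (¬ IsUnit (p : integerC F))]
  [IsAdicComplete (Ideal.span {(p : integerC F)}) (integerC F)]

namespace BdRPlusTop

/-- `ξ_dR ≠ 0` (as `t = ξ_dR·w ≠ 0`). [cite: FontaineAsterisque223III, Exp. II §1.5.5] -/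
theorem of_xiBdR_ne_zero (hθ : Function.Surjective (fontaineTheta (integerC F) p)) : of F p xiBdR ≠ 0 := by
  intro h
  obtain ⟨w, -, htw⟩ := exists_tBdR_eq_xiBdR_mul (F := F) (p := p) hθ
  exact tBdR_ne_zero (F := F) (p := p) hθ (by rw [htw]; exact mul_eq_zero_of_left h w)

omit [CharZero F] in
/-- Elements of `Fil¹` are multiples of `ξ_dR`. [cite: FontaineAsterisque223III, Exp. II §1.5.2] -/
theorem exists_eq_xi_mul (x : (filOne F p).toIdeal) : ∃ y : BdRPlusTop F p, (x : BdRPlusTop F p) = of F p xiBdR * y := by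
  obtain ⟨y, hy⟩ := Ideal.mem_span_singleton'.1 x.2
  exact ⟨y, by rw [← hy, mul_comm]; rfl⟩

/-- **The coordinate `x ↦ θ(x/ξ_dR)` on `Fil¹B_dR⁺`** (values in `ℂ_F`). [cite: FontaineAsterisque223III, Exp. II §1.5.2] -/
def grCoord (x : (filOne F p).toIdeal) : CompletedAlgClosure F :=
  thetaBdR ((of F p).symm (Classical.choose (exists_eq_xi_mul x)))

omit [CharZero F] in
/-- `x = ξ_dR · y(x)` for the chosen quotient. [cite: FontaineAsterisque223III, Exp. II §1.5.2] -/
theorem eq_xi_mul_choose (x : (filOne F p).toIdeal) :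
    (x : BdRPlusTop F p) = of F p xiBdR * Classical.choose (exists_eq_xi_mul x) :=
  Classical.choose_spec (exists_eq_xi_mul x)

/-- **Well-definedness**: `grCoord x = θ(y)` for ANY `y` with `x = ξ_dR·y` (`B_dR⁺` is a domain).
[cite: FontaineAsterisque223III, Exp. II §1.5.2] -/
theorem grCoord_spec (hθ : Function.Surjective (fontaineTheta (integerC F) p)) (x : (filOne F p).toIdeal)
    {y : BdRPlusTop F p} (hy : (x : BdRPlusTop F p) = of F p xiBdR * y) : grCoord x = thetaBdR ((of F p).symm y) := by
  haveI : IsDomain (BdRPlusTop F p) := isDomain_bDeRhamPlus (F := F) (p := p) hθ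
  have h := (eq_xi_mul_choose x).symm.trans hy
  rw [grCoord, mul_left_cancel₀ (of_xiBdR_ne_zero hθ) h]

/-- **Additivity** of the coordinate. [cite: FontaineAsterisque223III, Exp. II §1.5.2] -/
theorem grCoord_add (hθ : Function.Surjective (fontaineTheta (integerC F) p)) (x x' : (filOne F p).toIdeal) :
    grCoord (x + x') = grCoord x + grCoord x' := by
  rw [grCoord_spec hθ (x + x') (y := Classical.choose (exists_eq_xi_mul x) + Classical.choose (exists_eq_xi_mul x'))
      (by rw [mul_add, ← eq_xi_mul_choose, ← eq_xi_mul_choose]; rfl), map_add, map_add]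
  rfl

/-- **The coordinate kills exactly `Fil²`**: `grCoord x = 0 ↔ x ∈ (ξ_dR)²`. [cite: FontaineAsterisque223III, Exp. II §1.5.2] -/
theorem grCoord_eq_zero_iff (hθ : Function.Surjective (fontaineTheta (integerC F) p)) (x : (filOne F p).toIdeal) :
    grCoord x = 0 ↔ (x : BdRPlusTop F p) ∈ (WithIdeal.i ^ 2 : Ideal (BdRPlusTop F p)) := by
  haveI : IsDomain (BdRPlusTop F p) := isDomain_bDeRhamPlus (F := F) (p := p) hθ
  have hx := eq_xi_mul_choose x
  set y := Classical.choose (exists_eq_xi_mul x) with hy_def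
  have key : grCoord x = 0 ↔ y ∈ (WithIdeal.i : Ideal (BdRPlusTop F p)) := by
    rw [grCoord, mem_ker_thetaBdR_iff]
    rfl
  rw [key, pow_two, hx, ideal_eq]
  constructor
  · intro h
    exact Ideal.mul_mem_mul (Ideal.mem_span_singleton_self _) h
  · intro h
    rw [Ideal.span_singleton_mul_span_singleton, Ideal.mem_span_singleton'] at h
    obtain ⟨z, hz⟩ := h
    have hyz : y = of F p xiBdR * z := mul_left_cancel₀ (of_xiBdR_ne_zero hθ) (by rw [← hz]; ring)
    rw [hyz]
    exact Ideal.mul_mem_right _ _ (Ideal.mem_span_singleton_self _)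

/-- Two elements of `Fil¹` congruent mod `Fil²` have the same coordinate. [cite: FontaineAsterisque223III, Exp. II §1.5.2] -/
theorem grCoord_eq_of_sub_mem (hθ : Function.Surjective (fontaineTheta (integerC F) p)) (x x' : (filOne F p).toIdeal)
    (h : (x : BdRPlusTop F p) - x' ∈ (WithIdeal.i ^ 2 : Ideal (BdRPlusTop F p))) : grCoord x = grCoord x' := by
  have h1 : grCoord (x - x') = 0 := (grCoord_eq_zero_iff hθ (x - x')).2 h
  have h2 : grCoord x = grCoord (x - x' + x') := by congr 1; abel
  rw [h2, grCoord_add hθ, h1, zero_add]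

end BdRPlusTop

namespace AinfTop

variable {hθ : Function.Surjective (fontaineTheta (integerC F) p)} (W : WeierstrassCurve ℤ)

/-- **The Hodge–Tate coordinate `θ([t]/ξ_dR) ∈ ℂ_F`** of a Tate-module point `t` of `Ŵ(𝒪_{ℂ_F})`.
[cite: Fontaine1982FormesDifferentielles, §5] [cite: Tate1967, §4] -/
def htCoord (hθ : Function.Surjective (fontaineTheta (integerC F) p)) (t : ℕ → (maxNilIdealC F).toIdeal)
    (ht0 : (t 0 : CBall F) = 0) (htp : ∀ n, mulPC F p W (t (n + 1)) = t n) : CompletedAlgClosure F :=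
  BdRPlusTop.grCoord (torsionLiftFil W hθ t ht0 htp)

/-- `htCoord t = 0 ↔ [t] ∈ Fil²` (`↔ HT(t) = 0`). [cite: Fontaine1982FormesDifferentielles, §5] -/
theorem htCoord_eq_zero_iff {t : ℕ → (maxNilIdealC F).toIdeal} (ht0 : (t 0 : CBall F) = 0)
    (htp : ∀ n, mulPC F p W (t (n + 1)) = t n) :
    htCoord W hθ t ht0 htp = 0 ↔ htClass W hθ t ht0 htp = 0 := by
  rw [htCoord, BdRPlusTop.grCoord_eq_zero_iff hθ, htClass, Ideal.Quotient.eq_zero_iff_mem]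

/-- **Additivity `htCoord (t ⊕ t') = htCoord t + htCoord t'`.** [cite: Fontaine1982FormesDifferentielles, §5] [cite: Tate1967, §4] -/
theorem htCoord_addSeq {t t' : ℕ → (maxNilIdealC F).toIdeal} (ht0 : (t 0 : CBall F) = 0) (ht0' : (t' 0 : CBall F) = 0)
    (htp : ∀ n, mulPC F p W (t (n + 1)) = t n) (htp' : ∀ n, mulPC F p W (t' (n + 1)) = t' n) :
    htCoord W hθ (addSeq F W t t') (coe_addSeq_zero W ht0 ht0') (mulPC_addSeq W htp htp') =
      htCoord W hθ t ht0 htp + htCoord W hθ t' ht0' htp' := by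
  rw [htCoord, htCoord, htCoord, ← BdRPlusTop.grCoord_add hθ]
  apply BdRPlusTop.grCoord_eq_of_sub_mem hθ
  have h := htClass_addSeq W (hθ := hθ) ht0 ht0' htp htp'
  rw [htClass, htClass, htClass, ← map_add, Ideal.Quotient.eq] at h
  exact h

end AinfTop

end Literature.NumberTheory.PAdicHodge

end
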